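import Literature.MathematicalPhysics.QuantumLattice.DWaveSource

/-!
# Crux `TwSeededEnsembleEquivalence` (stmt-HubbardSuperconductivity-1698), line `exposed-density-duality`
# (thermal member, skeleton v12) — stub `stub_ahmTransfer` (STUB F, AHM transfer)

Notation: `P_L = (pairField dWaveFormFactor L)ᴴ(pairField dWaveFormFactor L)`,
`K_L(μ) = hubbardTorusWith 2 L 1 U μ − (g/L²)P_L` (the seeded grand-canonical torus),
`p_L(β,μ) = log Re Z(β, K_L(μ))/(βL²)` (seeded pressure),
`p̃_L(β,μ,h) = log Re Z(β, dWaveSourceTorus L U μ h)/(βL²)` (sourced pressure) and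
`B̃_L(β,μ) = ⨆_{h ∈ ℝ} [p̃_L(β,μ,h) − h²/g]` (finite-volume Bogoliubov functional).

The approximating-Hamiltonian theorem for the seeded torus (item 1703; here the hypothesis `hAHM`,
its verbatim body, pointwise in `μ`) says: EASY HALF `p̃_L(β,μ,h) − h²/g ≤ p_L(β,μ)` for all `L, h`
(so the family under the `⨆` is bounded above and `B̃_L ≤ p_L`), HARD HALF `p_L ≤ p̃_L(h_L) − h_L²/g + ε`
eventually in `L` (so `p_L ≤ B̃_L + ε` eventually). Hence a two-sided secant bracket of `B̃_L(β,·)`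
at `μ₀` (hypothesis `hB`, tolerance `η/2`, step `τ`) transfers to the same bracket of `p_L(β,·)` at
`μ₀` with tolerance `η`: with `ε' = ητ/8` one has `0 ≤ p_L − B̃_L ≤ ε'` eventually at the three points
`μ₀, μ₀ ± τ`, so each one-sided secant moves by at most `ε'/τ = η/8`.

The real-analysis core is isolated in `secant_bracket_transfer` (abstract functions of
`(L, μ)`); the stub `stub_ahmTransfer` instantiates it. Pure bookkeeping, [folklore].
-/

set_option linter.dupNamespace false

namespace Summit.HubbardSuperconductivity.HubbardSuperconductivity.Theorems.TwSeededEnsembleEquivalence.ThermalDuality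

open Matrix Finset Literature.MathematicalPhysics.QuantumLattice
open scoped ComplexOrder Matrix.Norms.L2Operator

noncomputable section

/-- ABSTRACT SECANT-BRACKET TRANSFER. Two families `p, B` of real functions of `μ`, indexed by the
volume `L` (with its `NeZero L` instance), such that `B ≤ p` pointwise and `p ≤ B + ε` eventually in
`L` at every fixed `μ`: a two-sided secant bracket of `B_L` at `μ₀` around the slope `c` (every
tolerance `η`, some step `τ(η) > 0`, eventually in `L`) transfers to the same bracket for `p_L`.
Proof: take `hB` at `η/2`, `ε = ητ/8` at the points `μ₀ ± τ`, and `B_L(μ₀) ≤ p_L(μ₀)`. [folklore] -/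
theorem secant_bracket_transfer {c μ₀ : ℝ} (p B : ∀ L : ℕ, NeZero L → ℝ → ℝ)
    (hle : ∀ (L : ℕ) [inst : NeZero L] (μ : ℝ), B L inst μ ≤ p L inst μ)
    (hge : ∀ (μ ε : ℝ), 0 < ε → ∃ L₀ : ℕ, ∀ (L : ℕ) [inst : NeZero L], L₀ ≤ L →
      p L inst μ ≤ B L inst μ + ε)
    (hB : ∀ η : ℝ, 0 < η → ∃ τ : ℝ, 0 < τ ∧ ∃ L₀ : ℕ, ∀ (L : ℕ) [inst : NeZero L], L₀ ≤ L →
      (B L inst (μ₀ + τ) - B L inst μ₀) / τ ≤ c + η ∧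
        c - η ≤ (B L inst μ₀ - B L inst (μ₀ - τ)) / τ) :
    ∀ η : ℝ, 0 < η → ∃ τ : ℝ, 0 < τ ∧ ∃ L₀ : ℕ, ∀ (L : ℕ) [inst : NeZero L], L₀ ≤ L →
      (p L inst (μ₀ + τ) - p L inst μ₀) / τ ≤ c + η ∧
        c - η ≤ (p L inst μ₀ - p L inst (μ₀ - τ)) / τ := by
  intro η hη
  obtain ⟨τ, hτ, L₁, h₁⟩ := hB (η / 2) (half_pos hη)
  have hητ : 0 < η * τ := mul_pos hη hτ
  have hε : 0 < η * τ / 8 := by positivity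
  obtain ⟨Lb, hb⟩ := hge (μ₀ + τ) (η * τ / 8) hε
  obtain ⟨Lc, hc⟩ := hge (μ₀ - τ) (η * τ / 8) hε
  refine ⟨τ, hτ, max L₁ (max Lb Lc), fun L inst hL => ?_⟩
  obtain ⟨h1, h2⟩ := h₁ L (le_trans (le_max_left _ _) hL)
  have hb' := hb L (le_trans (le_trans (le_max_left _ _) (le_max_right _ _)) hL)
  have hc' := hc L (le_trans (le_trans (le_max_right _ _) (le_max_right _ _)) hL)
  have e0 := hle L μ₀
  constructor
  · rw [div_le_iff₀ hτ] at h1 ⊢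
    linarith
  · rw [le_div_iff₀ hτ] at h2 ⊢
    linarith

/-- STUB F — AHM TRANSFER (pointwise in `(U, g, β, μ₀)`). From the approximating-Hamiltonian theorem for the
seeded torus (item 1703, landed as `twApproximatingHamiltonian_proof`; hypothesis `hAHM` is its verbatim body: easy
half `p̃_L(h) − h²/g ≤ p_L` for all `L, h`, hard half `p_L ≤ p̃_L(h_L) − h_L²/g + ε` eventually, POINTWISE in `μ`) and
the secant bracket at `μ₀` of the finite-volume Bogoliubov functional `B̃_L(β,μ) = ⨆_h [p̃_L(β,μ,h) − h²/g]`
(hypothesis `hB`), the secant bracket of `p_L(β,·)` at `μ₀`: `0 ≤ p_L − B̃_L ≤ ε'` eventually at each of the three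
points `μ₀, μ₀ ± τ` (`ε' = ητ/8`), so the secants move by at most `2ε'/τ = η/4` (`⨆` is a genuine bounded supremum:
`≤ p_L` by the easy half). [folklore] -/
theorem stub_ahmTransfer :
    ∀ (δ U g β μ₀ : ℝ), 0 < g → 0 < β →
      (∀ (U μ β g : ℝ), 0 < β → 0 < g →
        (∀ (L : ℕ) [NeZero L] (h : ℝ),
          (Real.log (Matrix.partitionFn β (dWaveSourceTorus L U μ h)).re / (β * (L : ℝ) ^ 2)) - h ^ 2 / g ≤
            (Real.log (Matrix.partitionFn β (hubbardTorusWith 2 L 1 U μ - ((g / (L : ℝ) ^ 2 : ℝ) : ℂ) •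
              ((pairField dWaveFormFactor L)ᴴ * pairField dWaveFormFactor L))).re / (β * (L : ℝ) ^ 2))) ∧
        (∀ ε : ℝ, 0 < ε → ∃ L₀ : ℕ, ∀ (L : ℕ) [NeZero L], L₀ ≤ L → ∃ h : ℝ,
          (Real.log (Matrix.partitionFn β (hubbardTorusWith 2 L 1 U μ - ((g / (L : ℝ) ^ 2 : ℝ) : ℂ) •
            ((pairField dWaveFormFactor L)ᴴ * pairField dWaveFormFactor L))).re / (β * (L : ℝ) ^ 2)) ≤
            (Real.log (Matrix.partitionFn β (dWaveSourceTorus L U μ h)).re / (β * (L : ℝ) ^ 2)) - h ^ 2 / g + ε)) →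
      (∀ η : ℝ, 0 < η → ∃ τ : ℝ, 0 < τ ∧ ∃ L₀ : ℕ, ∀ (L : ℕ) [NeZero L], L₀ ≤ L →
        ((⨆ h : ℝ, ((Real.log (Matrix.partitionFn β (dWaveSourceTorus L U (μ₀ + τ) h)).re / (β * (L : ℝ) ^ 2)) -
            h ^ 2 / g)) -
          (⨆ h : ℝ, ((Real.log (Matrix.partitionFn β (dWaveSourceTorus L U μ₀ h)).re / (β * (L : ℝ) ^ 2)) -
            h ^ 2 / g))) / τ ≤ (1 - δ) + η ∧
        (1 - δ) - η ≤
        ((⨆ h : ℝ, ((Real.log (Matrix.partitionFn β (dWaveSourceTorus L U μ₀ h)).re / (β * (L : ℝ) ^ 2)) -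
            h ^ 2 / g)) -
          (⨆ h : ℝ, ((Real.log (Matrix.partitionFn β (dWaveSourceTorus L U (μ₀ - τ) h)).re / (β * (L : ℝ) ^ 2)) -
            h ^ 2 / g))) / τ) →
      ∀ η : ℝ, 0 < η → ∃ τ : ℝ, 0 < τ ∧ ∃ L₀ : ℕ, ∀ (L : ℕ) [NeZero L], L₀ ≤ L →
        ((Real.log (Matrix.partitionFn β (hubbardTorusWith 2 L 1 U (μ₀ + τ) - ((g / (L : ℝ) ^ 2 : ℝ) : ℂ) •
            ((pairField dWaveFormFactor L)ᴴ * pairField dWaveFormFactor L))).re / (β * (L : ℝ) ^ 2)) -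
          (Real.log (Matrix.partitionFn β (hubbardTorusWith 2 L 1 U μ₀ - ((g / (L : ℝ) ^ 2 : ℝ) : ℂ) •
            ((pairField dWaveFormFactor L)ᴴ * pairField dWaveFormFactor L))).re / (β * (L : ℝ) ^ 2))) / τ ≤
          (1 - δ) + η ∧
        (1 - δ) - η ≤
        ((Real.log (Matrix.partitionFn β (hubbardTorusWith 2 L 1 U μ₀ - ((g / (L : ℝ) ^ 2 : ℝ) : ℂ) •
            ((pairField dWaveFormFactor L)ᴴ * pairField dWaveFormFactor L))).re / (β * (L : ℝ) ^ 2)) -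
          (Real.log (Matrix.partitionFn β (hubbardTorusWith 2 L 1 U (μ₀ - τ) - ((g / (L : ℝ) ^ 2 : ℝ) : ℂ) •
            ((pairField dWaveFormFactor L)ᴴ * pairField dWaveFormFactor L))).re / (β * (L : ℝ) ^ 2))) / τ := by
  intro δ U g β μ₀ hg hβ hAHM hB
  -- the family under the `⨆` is bounded above by the seeded pressure (AHM easy half)
  have bdd : ∀ (L : ℕ) [NeZero L] (μ : ℝ), BddAbove (Set.range fun h : ℝ =>
      (Real.log (Matrix.partitionFn β (dWaveSourceTorus L U μ h)).re / (β * (L : ℝ) ^ 2)) - h ^ 2 / g) :=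
    fun L _ μ => ⟨_, Set.forall_mem_range.2 fun h => (hAHM U μ β g hβ hg).1 L h⟩
  refine secant_bracket_transfer (c := 1 - δ) (μ₀ := μ₀)
    (fun (L : ℕ) (inst : NeZero L) (μ : ℝ) =>
      Real.log (Matrix.partitionFn β (hubbardTorusWith 2 L 1 U μ - ((g / (L : ℝ) ^ 2 : ℝ) : ℂ) •
        ((pairField dWaveFormFactor L)ᴴ * pairField dWaveFormFactor L))).re / (β * (L : ℝ) ^ 2))
    (fun (L : ℕ) (inst : NeZero L) (μ : ℝ) =>
      ⨆ h : ℝ, ((Real.log (Matrix.partitionFn β (dWaveSourceTorus L U μ h)).re / (β * (L : ℝ) ^ 2)) -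
        h ^ 2 / g))
    ?_ ?_ hB
  · intro L inst μ
    exact ciSup_le fun h => (hAHM U μ β g hβ hg).1 L h
  · intro μ ε hε
    obtain ⟨L₀, hL₀⟩ := (hAHM U μ β g hβ hg).2 ε hε
    refine ⟨L₀, fun L inst hL => ?_⟩
    obtain ⟨h, hh⟩ := hL₀ L hL
    exact hh.trans (add_le_add_left (le_ciSup (bdd L μ) h) ε)

end

end Summit.HubbardSuperconductivity.HubbardSuperconductivity.Theorems.TwSeededEnsembleEquivalence.ThermalDuality
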